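import Summits.BirchSwinnertonDyer.BirchSwinnertonDyer.Theorems.GoldfeldAllTwistsTwoConverseTwinAdditiveTamagawaClassNegSix
import Summits.BirchSwinnertonDyer.BirchSwinnertonDyer.Theorems.GoldfeldAllTwistsTwoConverseTwinBirchLocalTen
import HarnessLib

set_option linter.dupNamespace false -- `…BirchSwinnertonDyer.BirchSwinnertonDyer…` is the cell's namespace (D-0017)
set_option autoImplicit false

/-!
# Twin″ (item 19140), the WHOLE additive cell — uniform local arithmetic, IV: **`c₇(49a1^{(d)}) = 2` for every
# `7 ∤ d`** and **`c₂(49a1^{(d)}) = 4` for every squarefree `d ≢ 1 (mod 4)`** (square-class transport to seven certificates)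

Cell `bsd-goldfeld`, seat `bsd-goldfeld-s1p-c301` (prover, gen 11). Support for item `stmt-BirchSwinnertonDyer-19140`
(crux twin″ `BSDTwoCMSevenAdditiveRankOne`). Theses-free; theorems only; no `sorry`. HONEST FRAMING: local arithmetic
of explicit Weierstrass models; nothing about `L`-values; BSD is not proved by any of this and no case of twin″ is claimed.

`c_p` of a quadratic twist `E^{(D)} ⊗ ℚ_p` depends only on the class of `D` in `ℚ_pˣ/ℚ_pˣ²` (seat c301 gen 8,
`localTamagawaNumber_padic_quadraticTwist_eq_of_sq`). For `X₀(49) = cm7` and the twists `X₀(49)^{(4d)} ≅ 49a1^{(d)}`: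
* §1 at `7` (`7 ∤ d`): `(d/7) = +1` ⇒ `4d ∈ ℚ₇ˣ²` ⇒ `≅ X₀(49)` over `ℚ₇`, `c₇ = 2` (type `III`, gen 8
  `localTamagawaNumber_padic_cm7_seven`); `(d/7) = −1` ⇒ `−d ∈ ℚ₇ˣ²` (`−1` is a non-residue mod `7`) ⇒ `4d ∈ −4·ℚ₇ˣ²` ⇒
  `≅ X₀(49)^{(−4)} ≅ W₇₈₄` over `ℚ₇`, `c₇ = 2` (type `III`, gen 6 `localTamagawaNumber_W784_seven`). Hence
  **`c₇(49a1^{(d)}) = 2` for every `7 ∤ d`** (`localTamagawaNumber_padic_cellTwist_seven`) — on the whole `7`-inert half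
  AND the whole `7`-split half of the cell (seat c301 gen 8 did `d = −q`, `localTamagawaNumber_padic_twist_seven`).
* §3 at `2`, all six additive classes (`d` squarefree, `d ≢ 1 (mod 4)`; `u ≡ 1 (mod 8) ⇒ u ∈ ℤ₂ˣ²`): `d ≡ 7 (8)` → `−4`
  (W₇₈₄); `d ≡ 3 (8)` → `−20` (E₋₅); `d = 2m`: `m ≡ 1 (8)` → `2` (E₂ = 3136⁺, seat c3 gen 12, via
  `twoTorsionChange_smul_cm7_quadraticTwist_two_rat`); `m ≡ 3 (8)` → `−40` (E₋₁₀); `m ≡ 5 (8)` → `−24` (file III, NEW);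
  `m ≡ 7 (8)` → `−8` (W₃₁₃₆). Hence **`c₂(49a1^{(d)}) = 4` on the whole additive cell** (`localTamagawaNumber_padic_cellTwist_two`).
CONSEQUENCE (with file II, `c_ℓ ∈ {2, 4}` at odd `ℓ ∣ d` by `(−7/ℓ)`): `∏_p c_p(49a1^{(d)}) = 2^(3 + ι(d) + 2σ(d))` on the
cell, `ι / σ` = the number of odd prime factors of `d` inert / split in `ℚ(√−7)` — the exponent `v` of memos
INERT7-FORMULA-CENSUS §0.2 / B49K-SCOPING §2, i.e. the local factor of the BSD₂ quotient of EVERY curve of twin″.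
Numerics: kit j277601 (PARI `elllocalred`, all 485 squarefree `|d| ≤ 400`): `c₂ = 4` with Kodaira `I₄*` (`d` odd) /
`I₈*` (`d` even) for every `d ≢ 1 (mod 4)`; `c₇ = 2` (type `III`) for every `7 ∤ d`.
References: [Silverman1994] IV.9.4 Steps 4, 7, Table 4.1; [SilvermanAEC2009] VII.6, X.5 Cor. 5.4; [Serre1973] II.3.3
Thms 3–4; [CremonaAlgorithms1997] Table 1 (N = 49, 784, 3136).
-/

noncomputable section

open scoped Classical NumberField

open WeierstrassCurve IsDedekindDomain IsLocalRing Rat.HeightOneSpectrum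
  Literature.NumberTheory.EllipticCurves Literature.NumberTheory.EllipticCurves.ModularForms
  Literature.NumberTheory.QuadraticForms
  Summit.BirchSwinnertonDyer.BirchSwinnertonDyer.Rank2Observatory.Tate
  Summit.BirchSwinnertonDyer.BirchSwinnertonDyer.Rank2Observatory.RootNumber

namespace Summit.BirchSwinnertonDyer.BirchSwinnertonDyer.Theorems.GoldfeldGoodTwists

/-! ## §1 The place `7`: `c₇ = 2` on both `ℚ₇ˣ`-square classes prime to `7`

(The instance `Fact (Nat.Prime 7)` is a section hypothesis: callers supply `⟨by norm_num⟩`.) -/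

section Seven

variable [Fact (Nat.Prime 7)]

/-- A `7`-adic unit integer whose residue is a square is a square in `ℚ₇`: `n = θ²`, `θ ≠ 0`.
[cite: Serre1973, Ch. II §3.3 Thm 3] -/
theorem exists_sq_eq_padic_seven_of_isSquare {n : ℤ} (h7 : ¬ (7 : ℤ) ∣ n) (hsq : IsSquare ((n : ℤ) : ZMod 7)) :
    ∃ θ : ℚ_[7], θ ≠ 0 ∧ ((n : ℚ) : ℚ_[7]) = θ ^ 2 := by
  have hU : IsUnit ((n : ℤ_[7])) := by
    rw [PadicInt.isUnit_iff]
    have hle := PadicInt.norm_le_one ((n : ℤ_[7]))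
    have hlt : ¬ ‖((n : ℤ_[7]))‖ < 1 := fun h => h7 ((PadicInt.norm_int_lt_one_iff_dvd _).mp (by exact_mod_cast h))
    exact le_antisymm hle (not_lt.mp hlt)
  have hsq' : IsSquare ((n : ℤ_[7])) := by
    have h := (padicInt_isSquare_unit_iff_toZMod (p := 7) (by norm_num) hU.unit).mpr (by
      rw [IsUnit.unit_spec, map_intCast]; exact hsq)
    rwa [IsUnit.unit_spec] at h
  obtain ⟨s, hs⟩ := hsq'
  refine ⟨(s : ℚ_[7]), ?_, ?_⟩
  · intro hs0
    rw [PadicInt.coe_eq_zero] at hs0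
    rw [hs0, mul_zero] at hs
    exact hU.ne_zero hs
  · rw [sq, ← PadicInt.coe_mul, ← hs, PadicInt.coe_intCast]
    push_cast
    ring

/-- `X₀(49)^{(−4)} ≅ W₇₈₄` over `ℚ`, so **`c₇(X₀(49)^{(−4)}) = 2`** (Mathlib's `7`-adics; `c₇(W₇₈₄) = 2`, type `III`,
seat c301 gen 6 file VIII). [cite: Silverman1994, IV.9.4 Step 4 and Table 4.1] [cite: CremonaAlgorithms1997, Table 1 (N = 784)] -/
theorem localTamagawaNumber_padic_cm7_quadraticTwist_neg_four_seven :
    (haveI := cm7.isElliptic_quadraticTwist (show (-4 : ℚ) ≠ 0 by norm_num)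
     ((cm7.quadraticTwist (-4)).baseChange ℚ_[7]).localTamagawaNumber ℤ_[7]) = 2 := by
  haveI := cm7.isElliptic_quadraticTwist (show (-4 : ℚ) ≠ 0 by norm_num)
  haveI := isElliptic_twoTorsionModel_neg_one
  -- `c₇(W₇₈₄) = 2` in Mathlib's `7`-adics
  set w : HeightOneSpectrum (𝓞 ℚ) := (primesEquiv (R := 𝓞 ℚ)).symm ⟨7, by norm_num⟩ with hw
  have hw7 : (primesEquiv w : ℕ) = 7 := by rw [hw, Equiv.apply_symm_apply]
  have hgen : natGenerator w = 7 := by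
    rw [hw]; exact Literature.NumberTheory.GaloisRepresentations.Rat.natGenerator_primesEquiv_symm ⟨7, _⟩
  have h784 : (((⟨0, -21, 0, 112, 0⟩ : WeierstrassCurve ℚ).baseChange ℚ_[7]).localTamagawaNumber ℤ_[7]) = 2 := by
    rw [localTamagawaNumber_padic_eq_holds _ w 7 hw7]
    exact localTamagawaNumber_W784_seven w hgen
  set C := ((⟨(Units.mk0 (2 : ℚ) two_ne_zero)⁻¹, -2, 0, 0⟩ : VariableChange ℚ) *
    (⟨(Units.mk0 (2 : ℚ) two_ne_zero)⁻¹, 0, 0, 0⟩ : VariableChange ℚ)⁻¹) with hC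
  have e : (⟨0, -21, 0, 112, 0⟩ : WeierstrassCurve ℚ).baseChange ℚ_[7] =
      (C.map (algebraMap ℚ ℚ_[7])) • (cm7.quadraticTwist (-4)).baseChange ℚ_[7] := by
    rw [← VariableChange.baseChange_smul_eq, smul_cm7_quadraticTwist_neg_four_eq_W784]
  rw [e, WeierstrassCurve.localTamagawaNumber_variableChange_holds ℤ_[7] ((cm7.quadraticTwist (-4)).baseChange ℚ_[7])]
    at h784
  exact h784

/-- **`c₇(49a1^{(d)}) = 2` for EVERY `7 ∤ d`** (Mathlib's `7`-adics, on `X₀(49)^{(4d)} ≅ 49a1^{(d)}`):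
`(d/7) = +1` ⇒ `4d = (2θ)²` in `ℚ₇` ⇒ `≅ X₀(49)^{(1)} ≅ X₀(49)`; `(d/7) = −1` ⇒ `−d = θ²` (`−1` is a non-residue mod `7`)
⇒ `4d = (−4)·θ²` ⇒ `≅ X₀(49)^{(−4)} ≅ W₇₈₄`; both have type `III`, `c₇ = 2`. Seat c301 gen 8 did `d = −q`
(`localTamagawaNumber_padic_twist_seven`). [cite: SilvermanAEC2009, X.5 Cor. 5.4 and VII.6]
[cite: Silverman1994, IV.9.4 Step 4 and Table 4.1] -/
theorem localTamagawaNumber_padic_cellTwist_seven {d : ℤ} (h7 : ¬ (7 : ℤ) ∣ d) :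
    (haveI := cm7.isElliptic_quadraticTwist (show (((4 * d : ℤ)) : ℚ) ≠ 0 by
       exact_mod_cast (show (4 * d : ℤ) ≠ 0 from fun h => h7 ⟨0, by omega⟩))
     ((cm7.quadraticTwist (((4 * d : ℤ)) : ℚ)).baseChange ℚ_[7]).localTamagawaNumber ℤ_[7]) = 2 := by
  have hd : (((4 * d : ℤ)) : ℚ) ≠ 0 := by exact_mod_cast (show (4 * d : ℤ) ≠ 0 from fun h => h7 ⟨0, by omega⟩)
  have hd7 : ((d : ℤ) : ZMod 7) ≠ 0 := by
    intro h
    exact h7 (by exact_mod_cast (ZMod.intCast_zmod_eq_zero_iff_dvd d 7).mp h)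
  by_cases hsq : IsSquare ((d : ℤ) : ZMod 7)
  · -- `4d = 1 · (2θ)²`
    obtain ⟨θ, hθ, hθ2⟩ := exists_sq_eq_padic_seven_of_isSquare h7 hsq
    have h : ((((4 * d : ℤ)) : ℚ) : ℚ_[7]) = ((1 : ℚ) : ℚ_[7]) * (2 * θ) ^ 2 := by
      push_cast
      rw [show ((d : ℚ) : ℚ_[7]) = ((d : ℚ) : ℚ_[7]) from rfl] at hθ2
      have : ((d : ℤ) : ℚ_[7]) = θ ^ 2 := by exact_mod_cast hθ2
      rw [this]; ring
    rw [localTamagawaNumber_padic_quadraticTwist_eq_of_sq cm7 one_ne_zero hd (mul_ne_zero two_ne_zero hθ) h]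
    haveI := cm7.isElliptic_quadraticTwist (one_ne_zero (α := ℚ))
    have e : (cm7.quadraticTwist 1).baseChange ℚ_[7] =
        ((⟨1, 0, -(1 / 2 : ℚ), 0⟩ : VariableChange ℚ).map (algebraMap ℚ ℚ_[7])) • cm7.baseChange ℚ_[7] := by
      rw [← VariableChange.baseChange_smul_eq, completeSquare_smul_cm7]
    rw [e, WeierstrassCurve.localTamagawaNumber_variableChange_holds ℤ_[7] (cm7.baseChange ℚ_[7])]
    exact localTamagawaNumber_padic_cm7_seven
  · -- `−d` is a square mod `7` (`−1` is not), so `4d = (−4) · θ²` with `θ² = −d`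
    have hsq' : IsSquare (((-d : ℤ)) : ZMod 7) := by
      have h1 : legendreSym 7 d = -1 := (legendreSym.eq_neg_one_iff 7).mpr hsq
      have h2 : legendreSym 7 (-d) = 1 := by
        rw [show (-d : ℤ) = -1 * d by ring, legendreSym.mul, legendreSym.at_neg_one (by norm_num),
          ZMod.χ₄_nat_three_mod_four (by norm_num), h1]
        norm_num
      have hres : (((-d : ℤ)) : ZMod 7) ≠ 0 := by rw [Int.cast_neg]; exact neg_ne_zero.mpr hd7
      exact (legendreSym.eq_one_iff 7 hres).mp h2
    obtain ⟨θ, hθ, hθ2⟩ := exists_sq_eq_padic_seven_of_isSquare (n := -d) (by rwa [dvd_neg]) hsq'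
    have h : ((((4 * d : ℤ)) : ℚ) : ℚ_[7]) = ((-4 : ℚ) : ℚ_[7]) * θ ^ 2 := by
      have : (((-d : ℤ)) : ℚ_[7]) = θ ^ 2 := by exact_mod_cast hθ2
      push_cast at this ⊢
      linear_combination (-4) * this
    rw [localTamagawaNumber_padic_quadraticTwist_eq_of_sq cm7 (by norm_num) hd hθ h]
    exact localTamagawaNumber_padic_cm7_quadraticTwist_neg_four_seven

end Seven

/-! ## §2 The place `2`: `c₂ = 4` on all six classes of the additive cell -/

section Two

/-- An integer `m ≡ 1 (mod 8)` is a square in `ℤ₂`. [cite: Serre1973, Ch. II §3.3 Thm 4] -/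
theorem isSquare_padicInt_two_of_int_emod_eight {m : ℤ} (hm : m % 8 = 1) : IsSquare ((m : ℤ_[2])) := by
  refine padicInt_isSquare_of_toZModPow_three_eq_one (p := 2) ?_
  rw [map_intCast]
  have h : ((m : ℤ) : ZMod (2 ^ 3)) = (((m % 8 : ℤ)) : ZMod (2 ^ 3)) := by
    rw [show (2 : ℕ) ^ 3 = 8 by norm_num]
    exact (ZMod.intCast_mod m 8).symm
  rw [h, hm, Int.cast_one]

/-- From `(k·m : ℤ) = s·s` in `ℤ₂` with `k·m ≠ 0`: `s ≠ 0` in `ℚ₂`. [folklore] -/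
theorem coe_ne_zero_of_intCast_eq_mul_self {n : ℤ} (hn : n ≠ 0) {s : ℤ_[2]} (hs : (n : ℤ_[2]) = s * s) :
    ((s : ℤ_[2]) : ℚ_[2]) ≠ 0 := by
  intro h0
  rw [PadicInt.coe_eq_zero] at h0
  rw [h0, mul_zero] at hs
  exact hn (by exact_mod_cast hs)

/-- `c₂(X₀(49)^{(2)}) = 4` (Mathlib's `2`-adics): `(½, 4, 0, 0) • X₀(49)^{(2)} = E₂ = [0, 42, 0, 448, 0]` over `ℚ` and
`c₂(E₂) = 4` (seat c3 gen 12, file XIII `localTamagawaNumber_padic_twoTorsionModel_two_two`).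
[cite: Silverman1994, IV.9.4 Step 7 and Table 4.1] [cite: CremonaAlgorithms1997, Table 1 (N = 3136)] -/
theorem localTamagawaNumber_padic_cm7_quadraticTwist_two :
    (haveI := cm7.isElliptic_quadraticTwist (show (2 : ℚ) ≠ 0 by norm_num)
     ((cm7.quadraticTwist 2).baseChange ℚ_[2]).localTamagawaNumber ℤ_[2]) = 4 := by
  haveI := cm7.isElliptic_quadraticTwist (show (2 : ℚ) ≠ 0 by norm_num)
  haveI := isElliptic_twoTorsionModel_two
  have e : (⟨0, 42, 0, 448, 0⟩ : WeierstrassCurve ℚ).baseChange ℚ_[2] =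
      ((⟨(Units.mk0 (2 : ℚ) two_ne_zero)⁻¹, 4, 0, 0⟩ : VariableChange ℚ).map (algebraMap ℚ ℚ_[2])) •
        (cm7.quadraticTwist 2).baseChange ℚ_[2] := by
    rw [← VariableChange.baseChange_smul_eq, twoTorsionChange_smul_cm7_quadraticTwist_two_rat]
  have h := localTamagawaNumber_padic_twoTorsionModel_two_two
  rw [e, WeierstrassCurve.localTamagawaNumber_variableChange_holds ℤ_[2] ((cm7.quadraticTwist 2).baseChange ℚ_[2])]
    at h
  exact h

/-- **`c₂(49a1^{(d)}) = 4` for EVERY squarefree `d ≢ 1 (mod 4)`** (Mathlib's `2`-adics, on `X₀(49)^{(4d)} ≅ 49a1^{(d)}`):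
the class of `4d` in `ℚ₂ˣ/ℚ₂ˣ²` is read off `d mod 8` (`d` odd) or `d/2 mod 8` (`d` even) by `u ≡ 1 (mod 8) ⇒ u ∈ ℤ₂ˣ²`,
and transported to the representative `−4` (W₇₈₄), `−20` (E₋₅), `2` (E₂), `−40` (E₋₁₀), `−24` (file III), `−8` (W₃₁₃₆),
each with `c₂ = 4` (Kodaira `I₄*` for `d` odd, `I₈*` for `d` even).
[cite: Serre1973, Ch. II §3.3 Thm 4] [cite: Silverman1994, IV.9.4 Step 7 and Table 4.1] [cite: SilvermanAEC2009, X.5 Cor. 5.4] -/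
theorem localTamagawaNumber_padic_cellTwist_two {d : ℤ} (hsq : Squarefree d) (hd4 : d % 4 ≠ 1) :
    (haveI := cm7.isElliptic_quadraticTwist (show (((4 * d : ℤ)) : ℚ) ≠ 0 by
       have := hsq.ne_zero; exact_mod_cast (show (4 * d : ℤ) ≠ 0 by omega))
     ((cm7.quadraticTwist (((4 * d : ℤ)) : ℚ)).baseChange ℚ_[2]).localTamagawaNumber ℤ_[2]) = 4 := by
  have hd0 : d ≠ 0 := hsq.ne_zero
  have hd : (((4 * d : ℤ)) : ℚ) ≠ 0 := by exact_mod_cast (show (4 * d : ℤ) ≠ 0 by omega)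
  have h4 : ¬ (4 : ℤ) ∣ d := not_four_dvd_of_squarefree hsq
  have hcast : ((((4 * d : ℤ)) : ℚ) : ℚ_[2]) = 4 * ((d : ℤ) : ℚ_[2]) := by push_cast; ring
  rcases Int.emod_two_eq_zero_or_one d with heven | hodd
  · -- `d = 2m`, `m` odd
    obtain ⟨m, rfl⟩ : ∃ m, d = 2 * m := ⟨d / 2, by omega⟩
    have hm0 : m ≠ 0 := by rintro rfl; exact hd0 (by ring)
    rcases (show m % 8 = 1 ∨ m % 8 = 3 ∨ m % 8 = 5 ∨ m % 8 = 7 by omega) with h8 | h8 | h8 | h8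
    · -- class `2`: `m = s²`, `4·2m = 2·(2s)²`
      obtain ⟨s, hs⟩ := isSquare_padicInt_two_of_int_emod_eight h8
      have hθ := coe_ne_zero_of_intCast_eq_mul_self hm0 hs
      have hs' : ((m : ℤ) : ℚ_[2]) = ((s : ℤ_[2]) : ℚ_[2]) * ((s : ℤ_[2]) : ℚ_[2]) := by
        rw [← PadicInt.coe_mul, ← hs, PadicInt.coe_intCast]
      have h : ((((4 * (2 * m) : ℤ)) : ℚ) : ℚ_[2]) = ((2 : ℚ) : ℚ_[2]) * (2 * ((s : ℤ_[2]) : ℚ_[2])) ^ 2 := by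
        rw [hcast]; push_cast; rw [hs']; ring
      rw [localTamagawaNumber_padic_quadraticTwist_eq_of_sq cm7 (by norm_num) hd (mul_ne_zero two_ne_zero hθ) h]
      exact localTamagawaNumber_padic_cm7_quadraticTwist_two
    · -- class `−40`: `−5m = s²`, `8m = −40·(s/5)²`
      obtain ⟨s, hs⟩ := isSquare_padicInt_two_of_int_emod_eight (m := -5 * m) (by omega)
      have hθ : ((s : ℤ_[2]) : ℚ_[2]) / 5 ≠ 0 :=
        div_ne_zero (coe_ne_zero_of_intCast_eq_mul_self (by omega) hs) (by norm_num)
      have hs' : (((-5 * m : ℤ)) : ℚ_[2]) = ((s : ℤ_[2]) : ℚ_[2]) * ((s : ℤ_[2]) : ℚ_[2]) := by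
        rw [← PadicInt.coe_mul, ← hs, PadicInt.coe_intCast]
      have h : ((((4 * (2 * m) : ℤ)) : ℚ) : ℚ_[2]) = ((-40 : ℚ) : ℚ_[2]) * (((s : ℤ_[2]) : ℚ_[2]) / 5) ^ 2 := by
        rw [hcast, div_pow, sq, ← hs']; push_cast; ring
      rw [localTamagawaNumber_padic_quadraticTwist_eq_of_sq cm7 (by norm_num) hd hθ h]
      exact localTamagawaNumber_padic_cm7_quadraticTwist_neg_forty
    · -- class `−24`: `−3m = s²`, `8m = −24·(s/3)²`
      obtain ⟨s, hs⟩ := isSquare_padicInt_two_of_int_emod_eight (m := -3 * m) (by omega)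
      have hθ : ((s : ℤ_[2]) : ℚ_[2]) / 3 ≠ 0 :=
        div_ne_zero (coe_ne_zero_of_intCast_eq_mul_self (by omega) hs) (by norm_num)
      have hs' : (((-3 * m : ℤ)) : ℚ_[2]) = ((s : ℤ_[2]) : ℚ_[2]) * ((s : ℤ_[2]) : ℚ_[2]) := by
        rw [← PadicInt.coe_mul, ← hs, PadicInt.coe_intCast]
      have h : ((((4 * (2 * m) : ℤ)) : ℚ) : ℚ_[2]) = ((-24 : ℚ) : ℚ_[2]) * (((s : ℤ_[2]) : ℚ_[2]) / 3) ^ 2 := by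
        rw [hcast, div_pow, sq, ← hs']; push_cast; ring
      rw [localTamagawaNumber_padic_quadraticTwist_eq_of_sq cm7 (by norm_num) hd hθ h]
      exact localTamagawaNumber_padic_cm7_quadraticTwist_neg_twentyfour
    · -- class `−8`: `−m = s²`, `8m = −8·s²`
      obtain ⟨s, hs⟩ := isSquare_padicInt_two_of_int_emod_eight (m := -m) (by omega)
      have hθ := coe_ne_zero_of_intCast_eq_mul_self (neg_ne_zero.mpr hm0) hs
      have hs' : (((-m : ℤ)) : ℚ_[2]) = ((s : ℤ_[2]) : ℚ_[2]) * ((s : ℤ_[2]) : ℚ_[2]) := by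
        rw [← PadicInt.coe_mul, ← hs, PadicInt.coe_intCast]
      have h : ((((4 * (2 * m) : ℤ)) : ℚ) : ℚ_[2]) = ((-8 : ℚ) : ℚ_[2]) * ((s : ℤ_[2]) : ℚ_[2]) ^ 2 := by
        rw [hcast, sq, ← hs']; push_cast; ring
      rw [localTamagawaNumber_padic_quadraticTwist_eq_of_sq cm7 (by norm_num) hd hθ h]
      exact localTamagawaNumber_padic_cm7_quadraticTwist_neg_eight
  · -- `d` odd, `d ≢ 1 (mod 4)`: `d ≡ 3 (mod 4)`
    rcases (show d % 8 = 3 ∨ d % 8 = 7 by omega) with h8 | h8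
    · -- class `−20`: `−5d = s²`, `4d = −20·(s/5)²`
      obtain ⟨s, hs⟩ := isSquare_padicInt_two_of_int_emod_eight (m := -5 * d) (by omega)
      have hθ : ((s : ℤ_[2]) : ℚ_[2]) / 5 ≠ 0 :=
        div_ne_zero (coe_ne_zero_of_intCast_eq_mul_self (by omega) hs) (by norm_num)
      have hs' : (((-5 * d : ℤ)) : ℚ_[2]) = ((s : ℤ_[2]) : ℚ_[2]) * ((s : ℤ_[2]) : ℚ_[2]) := by
        rw [← PadicInt.coe_mul, ← hs, PadicInt.coe_intCast]
      have h : ((((4 * d : ℤ)) : ℚ) : ℚ_[2]) = ((-20 : ℚ) : ℚ_[2]) * (((s : ℤ_[2]) : ℚ_[2]) / 5) ^ 2 := by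
        rw [hcast, div_pow, sq, ← hs']; push_cast; ring
      rw [localTamagawaNumber_padic_quadraticTwist_eq_of_sq cm7 (by norm_num) hd hθ h]
      exact localTamagawaNumber_padic_cm7_quadraticTwist_neg_twenty
    · -- class `−4`: `−d = s²`, `4d = −4·s²`
      obtain ⟨s, hs⟩ := isSquare_padicInt_two_of_int_emod_eight (m := -d) (by omega)
      have hθ := coe_ne_zero_of_intCast_eq_mul_self (neg_ne_zero.mpr hd0) hs
      have hs' : (((-d : ℤ)) : ℚ_[2]) = ((s : ℤ_[2]) : ℚ_[2]) * ((s : ℤ_[2]) : ℚ_[2]) := by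
        rw [← PadicInt.coe_mul, ← hs, PadicInt.coe_intCast]
      have h : ((((4 * d : ℤ)) : ℚ) : ℚ_[2]) = ((-4 : ℚ) : ℚ_[2]) * ((s : ℤ_[2]) : ℚ_[2]) ^ 2 := by
        rw [hcast, sq, ← hs']; push_cast; ring
      rw [localTamagawaNumber_padic_quadraticTwist_eq_of_sq cm7 (by norm_num) hd hθ h]
      exact localTamagawaNumber_padic_cm7_quadraticTwist_neg_four

end Two

end Summit.BirchSwinnertonDyer.BirchSwinnertonDyer.Theorems.GoldfeldGoodTwists

end
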